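import Literature.MathematicalPhysics.QuantumLattice.LiebFluxPhaseRP
import HarnessLib

/-!
# Barrier: Lieb's fermionic reflection positivity needs the particle–hole-symmetric point — flux `π` through the cut plaquettes and the half-filled band; the zero-flux and the doped Hubbard torus are not reflection symmetric (Lieb 1994)

Barrier catalogue `Literature/Barriers/HubbardSuperconductivity/` (D-0021), entry
`LiebReflectionNeedsPiFluxHalfFilling`, for the summit `HubbardSuperconductivity` and its CUPRATE
QUESTION (cell `hubbard-cq`, LADDER row PC «positive-order certificate»: candidate PC-b "infrared-bound
analogue"). It records, AS PRINTED and PROVED in the tree's vocabulary, what the only spatial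
reflection positivity for hopping fermions in print (E. H. Lieb, *Flux phase of the half-filled
band*, PRL **73** (1994) 2158 [Lieb1994]; improved proof: Macris–Nachtergaele [MacrisNachtergaele1996];
general Majorana criterion: Jaffe–Pedrocchi [JaffePedrocchi2015], Jaffe–Janssens [JaffeJanssens2016])
requires of the Hamiltonian, and that the Hubbard model of the cuprate question violates it three
times over (flux `0`, doping `δ ≠ 0`, next-nearest-neighbour hopping `t′ ≠ 0`).

HONEST FRAMING: this is a statement about ONE proof technique (reflection positivity / Gaussian
domination / infrared bounds with Lieb's reflection `Θ`); it proves nothing about the presence or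
absence of order in the Hubbard model, and it is not a theorem that the doped model violates
reflection positivity for every conceivable reflection (see `scope_caveats`).

## What is printed (read in `paper:arxiv-cond-mat_9410025`, arXiv pages)

* [Lieb1994, p. 2, eq. (4)]: the hole–particle transformation `τ c_{xσ} τ⁻¹ = c†_{xσ}` satisfies
  `τ K(T↑, T↓) τ⁻¹ = K(-T↑*, -T↓*)`; `W⁰ = Σ U_x (n_{x↑} - ½)(n_{x↓} - ½)` is `τ`-invariant; "By h-p
  symmetry, `⟨N⟩ = |Λ|`, which is the half-filled band." "Henceforth, all graphs will be bipartite."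
* [Lieb1994, p. 3]: `Θ(H_L) = (τ R(H_L) τ⁻¹)^*` (geometric reflection `R`, hole–particle `τ`,
  complex conjugation), `θ(c_{lσ}) = c†_{rσ}`; "Note, from (4), that `Θ(K_L) = -R(K_L)`,
  `Θ(W^α) = R(W^α)`"; the `(-)` in `W^d_int` "comes from `τ(n_{x↑} + n_{x↓} - 1)τ⁻¹ = 1 - n_{x↑} - n_{x↓}`";
  the convention `t_{lr} = |t_{lr}| ≥ 0` on the bonds through the plane `P`; "the Hamiltonian is said
  to be reflection symmetric if `Θ(H_L) = H_R`"; LEMMA (reflection positivity), eq. (6):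
  `Z(H_L, H_R)² ≤ Z(H_L, Θ(H_L)) Z(Θ(H_R), H_R)`, and (7) for `H_R = Θ(H_L)`.
* [Lieb1994, p. 4]: THEOREM (flux `π` is optimal) and, in its proof, "the statement
  `K_R = Θ(K_L)` implies the flux `π` condition by (4)".

In the tree: the Lemma (6) is the THEOREM `Literature.MathematicalPhysics.QuantumLattice.LiebRP.partitionFn_sq_le_reflected`
(even `L × L` torus, `L ≥ 4`, arbitrary phases, any real `U`); the matrix of `Θ` is
`Literature.MathematicalPhysics.QuantumLattice.thetaMatrix` (`LiebFluxPhaseTheta.lean`) with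
`V n_i Vᴴ = 1 - n_{ρi}`, `V (c†_i c_j) Vᴴ = δ_ij - c†_{ρj} c_{ρi}` (eq. (4) in matrix form) and
`Θ(H_L(T)) = H_R(T′)`, `T′ = -` (mirrored conjugate amplitudes)
(`LiebRP.thetaT_conj_leftHamiltonian`). Nothing of that is restated here.

## What this file adds (all PROVED; no named fact other than the barrier `Prop`, itself a theorem)

Generic orbital sets `ι ≃ ι′` (the particle–hole SIGNATURE of `Θ` on the building blocks):
* `thetaMatrix_conj_creation_mul_creation`, `thetaMatrix_conj_annihilation_mul_annihilation(')` —
  `V (c†_i c†_j) Vᴴ = -(c_{ρi} c_{ρj})`, `V (c_p c_q) Vᴴ = (c_{ρp} c_{ρq})ᴴ` [Lieb1994, p. 3];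
* `thetaMatrix_conj_smul_sum_numberAt_sub_half` — the CHEMICAL POTENTIAL is `Θ`-odd:
  `V (μ Σ_{i∈S}(n_i - ½)) Vᴴ = -μ Σ_{i∈S}(n_{ρi} - ½)` [Lieb1994, p. 2];
* `thetaMatrix_conj_oneBody` — EVERY hopping amplitude is mirrored with the opposite sign:
  `V (Σ A_{ij} c†_i c_j) Vᴴ = (Σ A_{ii})·1 - Σ A_{ij} c†_{ρj} c_{ρi}` [Lieb1994, eq. (4)] — for
  nearest-neighbour bonds of a bipartite half this sign is compensated ONLY by flux `π` through the
  cut plaquettes (p. 4), for same-sublattice (next-nearest-neighbour, `t′`) bonds it is the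
  particle–hole asymmetry `t′ ↦ -t′` (tree: `particleHole_hubbardTorusTT'`, Lin–Hirsch 1987
  [LinHirsch1987]);
* `thetaMatrix_antilinear_conj_pairForm`, `thetaMatrix_antilinear_conj_pairSource` — a PAIR SOURCE
  `Δ_f + Δ_f†` (any complex form factor, e.g. the `d`-wave pinning field of the CQ pilots) is
  `Θ`-EVEN: `Θ(Δ_f + Δ_f†) = Δ^ρ_f + (Δ^ρ_f)†`. So the pinning field is not the obstruction.

On the even Hubbard torus (the tree's `LiebRP` set-up, `peierlsHubbard`, `W⁰ = U(n↑-½)(n↓-½)`):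
* `theta_conj_leftHamiltonian_uniform` — `Θ(H_L(t, U) + μ N′_L) = H_R(-t, U) - μ N′_R`
  (`N′ = Σ(n - ½) = shiftedNumber`): uniform real (zero-flux) hopping comes back with the opposite
  sign and the chemical potential with the opposite sign;
* the barrier `LiebReflectionNeedsPiFluxHalfFilling` and `liebReflectionNeedsPiFluxHalfFilling_holds`:
  **if the uniform zero-flux `t`–`U`–`μ` left Hamiltonian is reflection symmetric in Lieb's sense,
  `Θ(H_L + μN′_L) = H_R + μN′_R` (`L ≥ 4` even), then `t = 0` and `μ = 0`** (vacuum matrix element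
  ⇒ `μ = 0`; one-electron matrix element across a right bond ⇒ `t = 0`).

BARRIER (D-0021), HubbardSuperconductivity (cuprate question, LADDER row PC):
technique_class: spatial reflection positivity for lattice fermions with Lieb's antilinear particle–hole reflection `Θ = * ∘ τ ∘ R` through bond-bisecting planes, and everything downstream of it — Gaussian domination, chessboard estimates, Dyson–Lieb–Simon / Kennedy–Lieb–Shastry infrared bounds (`T > 0`: `Matrix.falkBruch_sum_le`; `T = 0`: `Matrix.groundState_infraredBound`) [cite: Lieb1994, Lemma eq. (6)-(7)] [cite: DLS1978, Thm. 4.2] [cite: KLS1988JSP, eqs. (18)-(25)]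
blocks: an infrared-bound / Gaussian-domination FLOOR on `d`-wave pair order (PC-b) for the ZERO-flux square-lattice Hubbard model at ANY filling, and a fortiori at the cuprate point (`U = 8t`, `δ = 1/8`, `t′ ∈ {0, -t/4}`), obtained by transplanting [Lieb1994]/[KLS1988PRL]/[LSSY2005, Ch. 11]: the symmetry hypothesis `Θ(H_L) = H_R` under which (6)-(7) iterate to Gaussian domination fails (this file's theorem: uniform real hopping forces `t = 0`, a chemical potential forces `μ = 0`) [cite: Lieb1994, p. 3 ("reflection symmetric if Θ(H_L) = H_R") and p. 4 ("K_R = Θ(K_L) implies the flux π condition")]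
because: `Θ` contains the particle–hole map: `τKτ⁻¹ = K(-T^*)`, `Θ(K_L) = -R(K_L)`, `τ(n - 1)τ⁻¹ = 1 - n` [cite: Lieb1994, eq. (4), p. 2-3]; hence (i) the hopping INSIDE each half returns with the opposite sign — compensated by a gauge only if the flux through every cut plaquette is `π` (zero flux is excluded; same-sublattice `t′` bonds cannot be compensated at all: `t′ ↦ -t′` [cite: LinHirsch1987] [cite: EsslerEtAl2005, §2.2.4]), (ii) the chemical potential measured from half filling returns with the opposite sign [cite: Lieb1994, p. 2 ("which is the half-filled band")]; the hard-core-boson analogue is LSSY's "the hard core and half-filling conditions are essential because they imply a particle-hole symmetry" [cite: LSSY2005, Ch. 11 §11.1 and §11.2 (after (11.7))]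
evasions_known: (a) SPIN-space reflection positivity (no spatial reflection): Lieb 1989 (attractive `U` any filling; repulsive `U` at half filling) — ground-state uniqueness and spin, no infrared bound [cite: LiebPRL1989, Thms. 1-2]; Kubo–Kishi Gaussian domination for ON-SITE density fields — susceptibility CEILINGS `χ ≤ 1/(4|U|)`, attractive `U` at any `μ` (tree: `kuboKishi_spin_gaussianDomination_holds`), repulsive `U` only at `μ = U/2` (tree: `kuboKishi_charge_gaussianDomination_holds`) [cite: KuboKishi1990, Thms. 1-2]; (b) the π-flux half-filled model itself, where Lieb's `Θ`-symmetry holds [cite: Lieb1994, Theorem] [cite: MacrisNachtergaele1996]; (c) for BOSONS, loop-space reflection positivity without particle–hole symmetry [cite: QuitmannTaggi2023, Thm. 1.1] — not available for fermions; (d) the general criterion deciding RP for a GIVEN reflection of a Majorana/spin Hamiltonian (cross-plane coupling matrix `J⁰ ⪰ 0`) [cite: JaffeJanssens2016, Thm. 1 and Prop. 38] [cite: JaffePedrocchi2015] — PROVED in the FILS matrix realisation as `CouplingMatrixRP.nonneg_forall_iff_posSemidef` / `CouplingMatrixRP.exists_neg_of_neg_direction` (`ReflectionPositivityCouplingMatrix.lean`):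 a tool to test candidate reflections, no positive instance for the doped Hubbard model in print; (e) the CLASS for which Gaussian domination follows from positivity alone — completed squares of cross-plane differences of REAL operators, [cite: DLS1978, §4 eq. (41b) and Thm. 4.2] — PROVED abstractly as `CrossingFieldGD.trace_exp_crossingFieldExponent_le` / `CrossingFieldGD.groundEnergy_le_pencil` (`GaussianDominationCrossingField.lean`); a bond pair field of `hubbardTorusTT'` sits in no completed square of `H`; none published that yields an infrared bound for hopping fermions away from the particle–hole-symmetric point, and more generally no reflection-positivity-free proof of ANY infrared bound is known («the only way we currently have for proving the IRB is reflection positivity»; the quantum Heisenberg ferromagnet, not RP, has «no proof of the IRB and, consequently, no proof of low-temperature symmetry breaking») [cite: Biskup2009, §8 Problems 1-2, p. 33]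
scope_caveats: PROVED here is only the failure of Lieb's SYMMETRY HYPOTHESIS `Θ(H_L) = H_R` for the uniform zero-flux / doped torus (and the `Θ`-signature of `t′` and pair-source terms); NOT proved and NOT printed: (1) that the Gibbs state or the ground states of the doped / `t′` / zero-flux Hubbard model violate reflection positivity for EVERY reflection (Jaffe–Janssens decide RP only for a given `Θ` and its gauge transforms [cite: JaffeJanssens2016, Thm. 1, §6]); (2) that ground-state Gaussian domination in ENERGY form `E₀(H) ≤ E₀(H + tV + ½t²Q)` (the only input of the `T = 0` transfer `Matrix.groundState_infraredBound`) fails for the `d`-wave pair modes of the doped model — untested, not refuted; (3) a genuine FAILURE of reflection positivity is printed only for ferromagnetic exchange (the spin-½ Heisenberg ferromagnet) [cite: Speer1985] (as reported in [cite: Biskup2009, §7] and [cite: Nachtergaele2007, §3]); (4) Lieb's Lemma (6) itself needs no symmetry and holds for all phases and fillings built into `W⁰` (tree theorem `LiebRP.partitionFn_sq_le_reflected`) — what fails is the iteration to Gaussian domination / chessboard estimates; (5) the flux-`π` and `t′` consequences are read off eq. (4) (tree identities), the sentence "zero flux is not Θ-symmetric" is a corollary of [Lieb1994, p. 4], not a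 printed sentence
status: established [cite: Lieb1994, eq. (4), Lemma (6), Theorem] (this file's theorem `liebReflectionNeedsPiFluxHalfFilling_holds`; trust base Mathlib + the tree's `LiebFluxPhase*` files)

## References

* [Lieb1994] E. H. Lieb, *Flux phase of the half-filled band*, Phys. Rev. Lett. 73 (1994) 2158–2161
  (arXiv:cond-mat/9410025), pp. 2–4, eqs. (4)–(7).
* [MacrisNachtergaele1996] N. Macris, B. Nachtergaele, J. Stat. Phys. 85 (1996) 745–761.
* [JaffeJanssens2016] A. Jaffe, B. Janssens, *Characterization of reflection positivity: Majoranas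
  and spins*, Commun. Math. Phys. 346 (2016) 1021–1050 (arXiv:1506.04197), Thm. 1, Prop. 38, §6.
* [JaffePedrocchi2015] A. Jaffe, F. L. Pedrocchi, *Reflection positivity for Majoranas*, Ann. Henri
  Poincaré 16 (2015) 189–203.
* [Speer1985] E. R. Speer, *Failure of reflection positivity in the quantum Heisenberg ferromagnet*,
  Lett. Math. Phys. 10 (1985) 41–47 (not held; acq-01408 cite-only; content as reported by
  [Biskup2009] §7 pp. 32–33 and [Nachtergaele2007] §3 p. 7).
* [Biskup2009] M. Biskup, *Reflection positivity and phase transitions in lattice spin models*,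
  Lecture Notes in Math. 1970 (2009) (arXiv:math-ph/0610025), §7.
* [Nachtergaele2007] B. Nachtergaele, *Quantum spin systems after DLS 1978*, Proc. Sympos. Pure
  Math. 76.1 (2007) 47–68 (arXiv:math-ph/0603017), §3.
* [LSSY2005] Lieb–Seiringer–Solovej–Yngvason, *The Mathematics of the Bose Gas and its
  Condensation* (2005), Ch. 11 §11.1–11.2.
* [KuboKishi1990] K. Kubo, T. Kishi, Phys. Rev. B 41 (1990) 4866, Thms. 1–2.
* [LiebPRL1989] E. H. Lieb, Phys. Rev. Lett. 62 (1989) 1201, Thms. 1–2.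
* [LinHirsch1987] H. Q. Lin, J. E. Hirsch, Phys. Rev. B 35 (1987) 3359; [EsslerEtAl2005] §2.2.4.
* [DLS1978] Dyson–Lieb–Simon, J. Stat. Phys. 18 (1978) 335, Thm. 4.2; [KLS1988JSP] Kennedy–Lieb–
  Shastry, J. Stat. Phys. 53 (1988) 1019, eqs. (18)–(25); [KLS1988PRL] PRL 61 (1988) 2582;
  [QuitmannTaggi2023] Commun. Math. Phys. 400 (2023) 2081, Thm. 1.1; [Tasaki2020] §9.2.
-/

noncomputable section

open Matrix Finset
open Literature.MathematicalPhysics.QuantumLattice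
open scoped ComplexOrder

namespace Literature.Barriers.HubbardSuperconductivity

/-! ### The particle–hole signature of Lieb's reflection on the building blocks of a fermionic Hamiltonian -/

section Signature

variable {ι ι' : Type*} [LinearOrder ι] [LinearOrder ι'] [Fintype ι] [Fintype ι'] (ρ : ι ≃ ι')

/-- The fermion parity anticommutes with a creation operator: `(-1)^N c†_j = -c†_j (-1)^N`.
[cite: Tasaki2020, §9.2] -/
theorem parityOp_mul_creation_eq_neg (j : ι) :
    (parityOp : Matrix (Finset ι) (Finset ι) ℂ) * creation j = -(creation j * parityOp) := by
  ext s t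
  simp only [parityOp, diagonal_mul, mul_diagonal, Matrix.neg_apply, creation_apply]
  split_ifs with h
  · rw [h.2, Finset.card_insert_of_notMem h.1, pow_succ]
    ring
  · simp

/-- **`V (c†_i c†_j) Vᴴ = -(c_{ρ i} c_{ρ j})`**: Lieb's reflection `Θ = (τ R(·) τ⁻¹)^*`
(`θ(c_l) = c†_r`) maps a pair CREATION operator of the left algebra to (minus) the mirrored pair
ANNIHILATION operator. [cite: Lieb1994, p. 3 (definition of `Θ`)] -/
theorem thetaMatrix_conj_creation_mul_creation (i j : ι) :
    thetaMatrix ρ * (creation i * creation j) * (thetaMatrix ρ)ᴴ =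
      -(annihilation (ρ i) * annihilation (ρ j)) := by
  have hP : (parityOp : Matrix (Finset ι) (Finset ι) ℂ) * parityOp = 1 := JWSplit.parityOp_mul_parityOp
  have h : creation i * creation j =
      (creation i * parityOp) * (parityOp * creation j : Matrix (Finset ι) (Finset ι) ℂ) := by
    rw [Matrix.mul_assoc, ← Matrix.mul_assoc parityOp, hP, Matrix.one_mul]
  rw [h, thetaMatrix_conj_mul, thetaMatrix_conj_creation_mul_parityOp, parityOp_mul_creation_eq_neg,
    Matrix.mul_neg, Matrix.neg_mul, thetaMatrix_conj_creation_mul_parityOp, Matrix.mul_neg]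

/-- **`V (c_i c_j) Vᴴ = -(c†_{ρ i} c†_{ρ j})`** (adjoint form). [cite: Lieb1994, p. 3] -/
theorem thetaMatrix_conj_annihilation_mul_annihilation (i j : ι) :
    thetaMatrix ρ * (annihilation i * annihilation j) * (thetaMatrix ρ)ᴴ =
      -(creation (ρ i) * creation (ρ j)) := by
  have h : annihilation i * annihilation j = (creation j * creation i)ᴴ := by
    rw [conjTranspose_mul, creation, creation, conjTranspose_conjTranspose, conjTranspose_conjTranspose]
  rw [h, thetaMatrix_conj_conjTranspose, thetaMatrix_conj_creation_mul_creation, conjTranspose_neg,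
    conjTranspose_mul, creation, creation]

/-- `Θ` sends a pair annihilator to the ADJOINT of the mirrored pair annihilator:
`V (c_p c_q) Vᴴ = (c_{ρ p} c_{ρ q})ᴴ` (by the CAR `c†_a c†_b = -c†_b c†_a`). [cite: Lieb1994, p. 3] -/
theorem thetaMatrix_conj_annihilation_mul_annihilation' (p q : ι) :
    thetaMatrix ρ * (annihilation p * annihilation q) * (thetaMatrix ρ)ᴴ =
      (annihilation (ρ p) * annihilation (ρ q))ᴴ := by
  rw [thetaMatrix_conj_annihilation_mul_annihilation, conjTranspose_mul, creation_mul_creation_eq_neg,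
    creation, creation, neg_neg]

/-- A product of two annihilation operators is a real matrix: `(c_p c_q)ᴴᵀ = c_p c_q`. [folklore] -/
private theorem annihilation_mul_annihilation_conjTranspose_transpose (p q : ι) :
    (annihilation p * annihilation q)ᴴᵀ = annihilation p * annihilation q :=
  conjTranspose_transpose_of_transpose_eq_conjTranspose
    (mul_transpose_eq_conjTranspose (annihilation_transpose_eq_conjTranspose p)
      (annihilation_transpose_eq_conjTranspose q))

/-- **Pair fields are mapped to the adjoint of their mirror image by the ANTILINEAR `Θ`**: for every
complex form factor `f`, `Θ(Σ_{p,q} f_{pq} c_p c_q) := V (Σ f_{pq} c_p c_q)‾ Vᴴ = (Σ_{p,q} f_{pq} c_{ρp} c_{ρq})ᴴ`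
(the entrywise conjugate `X‾ = Xᴴᵀ` conjugates the coefficients, the Jordan–Wigner matrices being
real). [cite: Lieb1994, p. 3 (definition of `Θ`, `θ(c_l) = c†_r`)] -/
theorem thetaMatrix_antilinear_conj_pairForm (f : ι → ι → ℂ) :
    thetaMatrix ρ * (∑ p, ∑ q, f p q • (annihilation p * annihilation q))ᴴᵀ * (thetaMatrix ρ)ᴴ =
      (∑ p, ∑ q, f p q • (annihilation (ρ p) * annihilation (ρ q)))ᴴ := by
  rw [conjTranspose_sum, transpose_sum, conjTranspose_sum, Matrix.mul_sum, Matrix.sum_mul]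
  refine Finset.sum_congr rfl fun p _ => ?_
  rw [conjTranspose_sum, transpose_sum, conjTranspose_sum, Matrix.mul_sum, Matrix.sum_mul]
  refine Finset.sum_congr rfl fun q _ => ?_
  rw [conjTranspose_smul, transpose_smul, annihilation_mul_annihilation_conjTranspose_transpose,
    Matrix.mul_smul, Matrix.smul_mul, thetaMatrix_conj_annihilation_mul_annihilation',
    conjTranspose_smul]

/-- **A pair SOURCE is `Θ`-even**: for every complex form factor `f` the Hermitian source
`Δ_f + Δ_f†`, `Δ_f = Σ_{p,q} f_{pq} c_p c_q`, of the left algebra is mapped by the antilinear `Θ` onto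
the SAME source built on the mirrored orbitals: `Θ(Δ_f + Δ_f†) = Δ^ρ_f + (Δ^ρ_f)†`. Hence a uniform
pairing (pinning) field does not by itself break Lieb's reflection symmetry — the obstruction is the
hopping sign / flux and the chemical potential. [cite: Lieb1994, p. 3] -/
theorem thetaMatrix_antilinear_conj_pairSource (f : ι → ι → ℂ) :
    thetaMatrix ρ * ((∑ p, ∑ q, f p q • (annihilation p * annihilation q)) +
        (∑ p, ∑ q, f p q • (annihilation p * annihilation q))ᴴ)ᴴᵀ * (thetaMatrix ρ)ᴴ =
      (∑ p, ∑ q, f p q • (annihilation (ρ p) * annihilation (ρ q))) +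
        (∑ p, ∑ q, f p q • (annihilation (ρ p) * annihilation (ρ q)))ᴴ := by
  rw [conjTranspose_add, transpose_add, Matrix.mul_add, Matrix.add_mul,
    thetaMatrix_antilinear_conj_pairForm]
  have h : ∀ X : Matrix (Finset ι) (Finset ι) ℂ, (Xᴴ)ᴴᵀ = (Xᴴᵀ)ᴴ := fun X => by
    ext i j
    simp
  rw [h, thetaMatrix_conj_conjTranspose, thetaMatrix_antilinear_conj_pairForm,
    conjTranspose_conjTranspose, add_comm]

/-- **The chemical potential is `Θ`-odd**: for any set `S` of left orbitals and any coefficient `μ`,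
`V (μ Σ_{i∈S} (n_i - ½)) Vᴴ = -μ Σ_{i∈S} (n_{ρ i} - ½)` — the particle–hole map inside `Θ` sends
`n - ½ ↦ -(n - ½)` ("By h-p symmetry `⟨N⟩ = |Λ|`, which is the half-filled band").
[cite: Lieb1994, p. 2] -/
theorem thetaMatrix_conj_smul_sum_numberAt_sub_half (S : Finset ι) (μ : ℂ) :
    thetaMatrix ρ * (μ • ∑ i ∈ S, (numberAt i - (1 / 2 : ℂ) • (1 : Matrix (Finset ι) (Finset ι) ℂ))) *
        (thetaMatrix ρ)ᴴ =
      -(μ • ∑ i ∈ S, (numberAt (ρ i) - (1 / 2 : ℂ) • (1 : Matrix (Finset ι') (Finset ι') ℂ))) := by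
  rw [Matrix.mul_smul, Matrix.smul_mul, Matrix.mul_sum, Matrix.sum_mul, ← smul_neg,
    ← Finset.sum_neg_distrib]
  congr 1
  refine Finset.sum_congr rfl fun i _ => ?_
  rw [thetaMatrix_conj_numberAt_sub_half]

/-- **Every hopping amplitude is sign-reversed under `Θ`** (Lieb's eq. (4) `τ K(T) τ⁻¹ = K(-T^*)`,
summed): for arbitrary coefficients `A i j`,
`V (Σ_{i,j} A_{ij} c†_i c_j) Vᴴ = (Σ_i A_{ii})·1 - Σ_{i,j} A_{ij} c†_{ρ j} c_{ρ i}` — the diagonal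
(density) part picks up the particle–hole constant, the genuine hopping part (`i ≠ j`) changes sign.
[cite: Lieb1994, eq. (4)] -/
theorem thetaMatrix_conj_oneBody (A : ι → ι → ℂ) :
    thetaMatrix ρ * (∑ i, ∑ j, A i j • (creation i * annihilation j)) * (thetaMatrix ρ)ᴴ =
      (∑ i, A i i) • (1 : Matrix (Finset ι') (Finset ι') ℂ) -
        ∑ i, ∑ j, A i j • (creation (ρ j) * annihilation (ρ i)) := by
  rw [Matrix.mul_sum, Matrix.sum_mul, Finset.sum_smul, ← Finset.sum_sub_distrib]
  refine Finset.sum_congr rfl fun i _ => ?_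
  rw [Matrix.mul_sum, Matrix.sum_mul]
  have : ∑ j, thetaMatrix ρ * (A i j • (creation i * annihilation j)) * (thetaMatrix ρ)ᴴ =
      ∑ j, (A i j • ((if i = j then (1 : Matrix (Finset ι') (Finset ι') ℂ) else 0)) -
        A i j • (creation (ρ j) * annihilation (ρ i))) := by
    refine Finset.sum_congr rfl fun j _ => ?_
    rw [Matrix.mul_smul, Matrix.smul_mul, thetaMatrix_conj_creation_mul_annihilation, smul_sub]
  rw [this, Finset.sum_sub_distrib]
  simp only [smul_ite, smul_zero, Finset.sum_ite_eq, Finset.mem_univ, if_true]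

end Signature

/-! ### Matrix entries of the building blocks at the vacuum and on one-particle states -/

section Entries

variable {ι : Type*} [LinearOrder ι]

/-- The vacuum row of a creation operator vanishes: `⟨∅| c†_p = 0`. [folklore] -/
private theorem creation_apply_empty (p : ι) (u : Finset ι) : creation p ∅ u = 0 := by
  rw [creation_apply, if_neg]
  rintro ⟨-, h⟩
  exact Finset.insert_ne_empty p u h.symm

variable [Fintype ι]

/-- `⟨∅| c†_p c_q |u⟩ = 0`. [folklore] -/
private theorem creation_mul_annihilation_apply_empty (p q : ι) (u : Finset ι) :
    (creation p * annihilation q) ∅ u = 0 := by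
  simp [Matrix.mul_apply, creation_apply_empty]

/-- One-particle matrix elements of a hopping letter: `⟨{r}| c†_p c_q |{s}⟩ = [p = r][q = s]`.
[folklore] -/
private theorem creation_mul_annihilation_apply_singleton (p q r s : ι) :
    (creation p * annihilation q) {r} {s} = if p = r ∧ q = s then 1 else 0 := by
  rw [Matrix.mul_apply, Finset.sum_eq_single ∅]
  · rw [creation_apply, annihilation_apply]
    simp only [Finset.notMem_empty, not_false_eq_true, true_and, Finset.insert_empty,
      Finset.singleton_inj, jwSign, Finset.filter_empty, Finset.card_empty, pow_zero]
    by_cases hpr : p = r <;> by_cases hqs : q = s <;> simp [hpr, hqs, eq_comm]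
  · intro u _ hu
    rw [annihilation_apply, if_neg, mul_zero]
    rintro ⟨hq, hs⟩
    have hqs : q = s := Finset.mem_singleton.1 (hs ▸ Finset.mem_insert_self q u)
    obtain ⟨a, ha⟩ := Finset.nonempty_iff_ne_empty.2 hu
    have has : a = s := Finset.mem_singleton.1 (hs ▸ Finset.mem_insert_of_mem ha)
    exact hq (hqs ▸ has ▸ ha)
  · intro h
    exact absurd (Finset.mem_univ _) h

/-- Entries of the number operator: `⟨u| n_i |v⟩ = [u = v][i ∈ u]`. [cite: Tasaki2020, §9.2] -/
theorem numberAt_apply (i : ι) (u v : Finset ι) :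
    numberAt i u v = if u = v then (if i ∈ u then 1 else 0) else 0 := by
  rw [numberAt_eq_diagonal, diagonal_apply]

/-- The number operator is a diagonal matrix. [cite: Tasaki2020, §9.2] -/
theorem isDiag_numberAt (i : ι) : (numberAt i).IsDiag := by
  rw [numberAt_eq_diagonal]
  exact isDiag_diagonal _

/-- A finite sum of diagonal matrices is diagonal. [folklore] -/
private theorem isDiag_sum {κ : Type*} (s : Finset κ) {n : Type*} (f : κ → Matrix n n ℂ)
    (h : ∀ k ∈ s, (f k).IsDiag) : (∑ k ∈ s, f k).IsDiag := by
  induction s using Finset.cons_induction with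
  | empty => simp [Matrix.isDiag_zero]
  | cons a s ha ih =>
    rw [Finset.sum_cons]
    exact (h a (Finset.mem_cons_self a s)).add (ih fun k hk => h k (Finset.mem_cons_of_mem hk))

end Entries

/-! ### Entries of the hopping operator and of the shifted particle number -/

section PeierlsEntries

variable {Λ : Type*} [LinearOrder Λ] [Fintype Λ] (G : SimpleGraph Λ) [DecidableRel G.Adj]

/-- Entries of an `if`-guarded matrix. [folklore] -/
private theorem ite_apply₂ {m n : Type*} (P : Prop) [Decidable P] (A B : Matrix m n ℂ) (i : m)
    (j : n) : (if P then A else B) i j = if P then A i j else B i j := by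
  split_ifs <;> rfl

/-- The shifted particle number `N' = Σ_i (n_i - ½)` of an orbital set (`= N - ½·#orbitals`; the
operator multiplying the chemical potential measured from the half-filled band).
[cite: Lieb1994, p. 2] -/
abbrev shiftedNumber (ι : Type*) [LinearOrder ι] [Fintype ι] : Matrix (Finset ι) (Finset ι) ℂ :=
  ∑ i : ι, (numberAt i - (1 / 2 : ℂ) • (1 : Matrix (Finset ι) (Finset ι) ℂ))

/-- `N'` is diagonal. [folklore] -/
private theorem isDiag_shiftedNumber (ι : Type*) [LinearOrder ι] [Fintype ι] : (shiftedNumber ι).IsDiag :=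
  isDiag_sum _ _ fun i _ => (isDiag_numberAt i).sub (isDiag_one.smul _)

/-- The number operator is a real matrix: `n_iᴴᵀ = n_i`. [folklore] -/
private theorem numberAt_conjTranspose_transpose {ι : Type*} [LinearOrder ι] [Fintype ι] (i : ι) :
    (numberAt i)ᴴᵀ = numberAt i := by
  rw [numberAt_eq_diagonal, diagonal_conjTranspose, diagonal_transpose]
  congr 1
  funext s
  by_cases h : i ∈ s <;> simp [h]

/-- `N'` is a real matrix: `N'ᴴᵀ = N'`. [folklore] -/
private theorem shiftedNumber_conjTranspose_transpose (ι : Type*) [LinearOrder ι] [Fintype ι] :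
    (shiftedNumber ι)ᴴᵀ = shiftedNumber ι := by
  rw [shiftedNumber, conjTranspose_sum, transpose_sum]
  refine Finset.sum_congr rfl fun i _ => ?_
  rw [conjTranspose_sub, transpose_sub, conjTranspose_smul, transpose_smul, conjTranspose_one,
    transpose_one, numberAt_conjTranspose_transpose]
  congr 2
  simp

/-- The vacuum entry of `N'`: `⟨∅| N' |∅⟩ = -½ · #orbitals`. [folklore] -/
private theorem shiftedNumber_apply_empty_empty (ι : Type*) [LinearOrder ι] [Fintype ι] :
    shiftedNumber ι ∅ ∅ = -((Fintype.card ι : ℂ) / 2) := by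
  simp [shiftedNumber, Matrix.sum_apply, numberAt_apply, Finset.card_univ]
  ring

/-- The spin-summed hopping operator `Σ_{x ∼ y} Σ_σ S σ x y · c†_{xσ} c_{yσ}` of a graph with
amplitudes `S` (so that `peierlsHubbard G T U = -hoppingSum G T + U·W⁰`). [cite: Lieb1994, eq. (1)] -/
def hoppingSum (S : Fin 2 → Λ → Λ → ℂ) : Matrix (Finset (Orb Λ)) (Finset (Orb Λ)) ℂ :=
  ∑ x : Λ, ∑ y : Λ, ∑ σ : Fin 2,
    if G.Adj x y then S σ x y • (creation (orb x σ) * annihilation (orb y σ)) else 0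

/-- Two Peierls–Hubbard Hamiltonians with the same `U` differ by a hopping operator:
`H(T₁) - H(T₂) = hoppingSum (T₂ - T₁)`. [cite: Lieb1994, eqs. (1)-(2)] -/
theorem peierlsHubbard_sub (T₁ T₂ : Fin 2 → Λ → Λ → ℂ) (U : ℝ) :
    peierlsHubbard G T₁ U - peierlsHubbard G T₂ U = hoppingSum G (T₂ - T₁) := by
  rw [peierlsHubbard_def, peierlsHubbard_def, add_sub_add_right_eq_sub, neg_sub_neg, hoppingSum,
    ← Finset.sum_sub_distrib]
  refine Finset.sum_congr rfl fun x _ => ?_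
  rw [← Finset.sum_sub_distrib]
  refine Finset.sum_congr rfl fun y _ => ?_
  rw [← Finset.sum_sub_distrib]
  refine Finset.sum_congr rfl fun σ _ => ?_
  split_ifs
  · rw [Pi.sub_apply, Pi.sub_apply, Pi.sub_apply, sub_smul]
  · rw [sub_zero]

/-- The vacuum row of a hopping operator vanishes. [folklore] -/
private theorem hoppingSum_apply_empty (S : Fin 2 → Λ → Λ → ℂ) (u : Finset (Orb Λ)) :
    hoppingSum G S ∅ u = 0 := by
  simp [hoppingSum, Matrix.sum_apply, ite_apply₂, creation_mul_annihilation_apply_empty]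

/-- **One-electron matrix elements of a hopping operator**:
`⟨{(x,σ)}| hoppingSum S |{(y,σ)}⟩ = S σ x y` if `x ∼ y` and `0` otherwise. [cite: Lieb1994, eq. (1)] -/
theorem hoppingSum_apply_singleton (S : Fin 2 → Λ → Λ → ℂ) (x y : Λ) (σ : Fin 2) :
    hoppingSum G S {orb x σ} {orb y σ} = if G.Adj x y then S σ x y else 0 := by
  have key : ∀ x' y' : Λ, ∀ τ : Fin 2,
      (if G.Adj x' y' then S τ x' y' • (creation (orb x' τ) * annihilation (orb y' τ))
        else (0 : Matrix (Finset (Orb Λ)) (Finset (Orb Λ)) ℂ)) {orb x σ} {orb y σ} =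
        if σ = τ then (if y = y' then (if x = x' then (if G.Adj x y then S σ x y else 0) else 0)
          else 0) else 0 := by
    intro x' y' τ
    rw [ite_apply₂, Matrix.smul_apply, Matrix.zero_apply, creation_mul_annihilation_apply_singleton,
      smul_eq_mul]
    simp only [orb_eq_orb_iff]
    by_cases h1 : x = x'
    · by_cases h2 : y = y'
      · by_cases h3 : σ = τ
        · simp [h1, h2, h3]
        · simp [h3, Ne.symm h3]
      · simp [h2, Ne.symm h2]
    · simp [h1, Ne.symm h1]
  simp only [hoppingSum, Matrix.sum_apply, key, Finset.sum_ite_eq, Finset.mem_univ, if_true]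

end PeierlsEntries

/-! ### The barrier on the Hubbard torus: the zero-flux / doped model is not `Θ`-symmetric -/

section Torus

open LiebRP PeierlsSplit FermionTorus

attribute [local instance] LiebRP.decEqTorus

variable {L : ℕ} [NeZero L]

omit [NeZero L] in
/-- Under `Θ` uniform real amplitudes become their negatives: `reflAmpl (t) = (-t)`
(`Θ(K_L) = -R(K_L)`). [cite: Lieb1994, eq. (4)] -/
theorem reflAmpl_uniform (t : ℝ) :
    reflAmpl (fun (_ : Fin 2) (_ _ : FermionTorus 2 L) => (t : ℂ)) = fun _ _ _ => -(t : ℂ) := by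
  funext σ x y
  rw [reflAmpl_apply, Complex.star_def, Complex.conj_ofReal]

/-- **`Θ` of the left half of the uniform `t`–`U`–`μ` Hubbard torus**: Lieb's reflection sends the
left Hamiltonian with uniform real hopping `t`, interaction `U(n↑-½)(n↓-½)` and chemical potential
`μ` (coupled to `N'_L = Σ(n - ½)`) to the RIGHT Hamiltonian with hopping **`-t`** and chemical
potential **`-μ`**: `Θ(H_L(t,U) + μN'_L) = H_R(-t,U) - μN'_R`. [cite: Lieb1994, eq. (4) and p. 3] -/
theorem theta_conj_leftHamiltonian_uniform (hL : Even L) (h2 : 2 ≤ L) (t U μ : ℝ) :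
    thetaT hL * (leftHamiltonian (IsLeft L) (G L) (fun _ _ _ => (t : ℂ)) U +
        (μ : ℂ) • shiftedNumber (Orb (LS L)))ᴴᵀ * (thetaT hL)ᴴ =
      rightHamiltonian (IsLeft L) (G L) (fun _ _ _ => (-(t : ℂ))) U -
        (μ : ℂ) • shiftedNumber (Orb (RS L)) := by
  rw [conjTranspose_add, transpose_add, Matrix.mul_add, Matrix.add_mul,
    thetaT_conj_leftHamiltonian hL h2, reflAmpl_uniform, conjTranspose_smul, transpose_smul,
    shiftedNumber_conjTranspose_transpose, Complex.star_def, Complex.conj_ofReal, shiftedNumber,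
    thetaMatrix_conj_smul_sum_numberAt_sub_half, sub_eq_add_neg, shiftedNumber,
    ← Equiv.sum_comp (orbReflect hL) (fun j : Orb (RS L) =>
      numberAt j - (1 / 2 : ℂ) • (1 : Matrix (Finset (Orb (RS L))) (Finset (Orb (RS L))) ℂ))]

/-- BARRIER (D-0021) — see the module docstring for the structured block.
**Lieb reflection symmetry needs flux π and half filling**: if the left half of the uniform
zero-flux `t`–`U`–`μ` Hubbard Hamiltonian on the even `L × L` torus (`L ≥ 4`) is mapped by Lieb's
reflection `Θ` onto its right half — the symmetry hypothesis `Θ(H_L) = H_R` of the flux-phase /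
reflection-positivity method [Lieb1994, p. 3: "the Hamiltonian is said to be reflection symmetric
if `Θ(H_L) = H_R`"] — then `t = 0` and `μ = 0`: real uniform (zero-flux) hopping violates
`Θ(K_L) = -R(K_L)` (flux `π` through the cut plaquettes is forced, [Lieb1994, p. 4]) and a chemical
potential away from the half-filled band violates `Θ(n - ½) = -(n - ½)` [Lieb1994, p. 2].
[cite: Lieb1994, eq. (4), p. 3 and p. 4] -/
def LiebReflectionNeedsPiFluxHalfFilling : Prop :=
  ∀ (L : ℕ) [NeZero L] (hL : Even L), 4 ≤ L → ∀ (t U μ : ℝ),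
    thetaT hL * (leftHamiltonian (IsLeft L) (G L) (fun _ _ _ => (t : ℂ)) U +
          (μ : ℂ) • shiftedNumber (Orb (LS L)))ᴴᵀ * (thetaT hL)ᴴ =
        rightHamiltonian (IsLeft L) (G L) (fun _ _ _ => (t : ℂ)) U +
          (μ : ℂ) • shiftedNumber (Orb (RS L)) →
      t = 0 ∧ μ = 0

/-- A site of the left half: the origin (column `0 < L/2` for `L ≥ 2`). [folklore] -/
private theorem isLeft_origin (h2 : 2 ≤ L) : IsLeft L (toLex fun _ : Fin 2 => (0 : Fin L)) := by
  rw [isLeft_iff]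
  show ((ofLex (toLex fun _ : Fin 2 => (0 : Fin L))) 0 : ℕ) < L / 2
  rw [ofLex_toLex, Fin.val_zero]
  omega

/-- **The barrier is a theorem.** Proof: by `theta_conj_leftHamiltonian_uniform` the hypothesis
reads `H_R(-t) - μN'_R = H_R(t) + μN'_R`, i.e. `hoppingSum (2t) = 2μ N'_R` on the right half; its
vacuum matrix element gives `μ · #orbitals = 0`, and its matrix element between the one-electron
states at two vertically adjacent right sites gives `2t = 0`. [cite: Lieb1994, eq. (4), p. 3 and p. 4] -/
theorem liebReflectionNeedsPiFluxHalfFilling_holds : LiebReflectionNeedsPiFluxHalfFilling := by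
  intro L _ hL h4 t U μ hsym
  have h2 : 2 ≤ L := le_trans (by norm_num) h4
  rw [theta_conj_leftHamiltonian_uniform hL h2] at hsym
  -- the hypothesis as `H_R(-t) - H_R(t) = 2μ N'_R`, i.e. `hoppingSum (2t) = 2μ N'_R`
  have hdiff : rightHamiltonian (IsLeft L) (G L) (fun _ _ _ => (-(t : ℂ))) U -
      rightHamiltonian (IsLeft L) (G L) (fun _ _ _ => (t : ℂ)) U =
        ((μ : ℂ) + (μ : ℂ)) • shiftedNumber (Orb (RS L)) := by
    rw [eq_add_of_sub_eq hsym, add_smul]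
    abel
  rw [rightHamiltonian, rightHamiltonian, peierlsHubbard_sub] at hdiff
  -- two vertically adjacent sites of the right half
  set b : RS L := leftEquivRight hL ⟨toLex fun _ : Fin 2 => (0 : Fin L), isLeft_origin h2⟩ with hb
  have hb' : ¬IsLeft L (shift b.1 1) := by
    rw [isLeft_iff, col_shift_one, ← isLeft_iff]
    exact b.2
  set b' : RS L := ⟨shift b.1 1, hb'⟩ with hb'def
  have hadj : (G L).Adj b.1 b'.1 := adj_shift h2 b.1 1
  have hne : b ≠ b' := fun h => hadj.ne (congrArg Subtype.val h)
  -- (1) the vacuum entry: `μ = 0`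
  have e0 := congrArg (fun M : Matrix (Finset (Orb (RS L))) (Finset (Orb (RS L))) ℂ => M ∅ ∅) hdiff
  simp only [hoppingSum_apply_empty, Matrix.smul_apply, smul_eq_mul,
    shiftedNumber_apply_empty_empty] at e0
  have hcard : (Fintype.card (Orb (RS L)) : ℂ) ≠ 0 := by
    haveI : Nonempty (Orb (RS L)) := ⟨orb b 0⟩
    exact Nat.cast_ne_zero.2 Fintype.card_ne_zero
  have hμ : μ = 0 := by
    have h1 : (μ : ℂ) * (Fintype.card (Orb (RS L)) : ℂ) = 0 := by
      linear_combination e0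
    exact_mod_cast (mul_eq_zero.1 h1).resolve_right hcard
  -- (2) the one-electron entry between `b'` and `b`: `t = 0`
  have e1 := congrArg
    (fun M : Matrix (Finset (Orb (RS L))) (Finset (Orb (RS L))) ℂ => M {orb b' 0} {orb b 0}) hdiff
  have hsing : ({orb b' 0} : Finset (Orb (RS L))) ≠ {orb b 0} := by
    rw [Ne, Finset.singleton_inj, orb_eq_orb_iff]
    exact fun h => hne h.1.symm
  have hadj' : (rightGraph (IsLeft L) (G L)).Adj b' b := hadj.symm
  simp only [hoppingSum_apply_singleton, if_pos hadj', Pi.sub_apply, sub_neg_eq_add,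
    Matrix.smul_apply, smul_eq_mul, isDiag_shiftedNumber _ hsing, mul_zero] at e1
  have ht : t = 0 := by
    have h1 : (t : ℂ) = 0 := by linear_combination (1 / 2 : ℂ) * e1
    exact_mod_cast h1
  exact ⟨ht, hμ⟩

end Torus

end Literature.Barriers.HubbardSuperconductivity

end
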